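import Summits.HodgeConjecture.CorCM.GaloisTwentyFourDegenerateModels
import Mathlib.GroupTheory.SpecificGroups.Dihedral
import HarnessLib

/-!
# `Gal(K/ℚ) ≅ S₃ × C₄` and `D₅ × C₄` (complex conjugation in the cyclic quartic factor) are BAD: simple DEGENERATE CM abelian
# varieties of dimension 12 and 20

COR-CM (cell `pub-hodgecm2`), binder seat b04 (gen 32), count-neutral own lane «Galois-CM-type classification» (blanket
`CorCM/GaloisDihedral*`, b04).  HC_CM is NOT proved here; unconditional negative-side examples.  KERNEL ONLY: theorems (`decide`
certificates); no definition, no named fact, no `sorry`.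

`K` = (totally real Galois field with group `D_m = DihedralGroup m`, `m` odd) · (cyclic quartic CM field `M`), `Gal(K/ℚ) ≅ D_m × C₄`, complex
conjugation `(1, 2)`.  For `m ≥ 7` this row is BAD by gen 30's `CorCM/GaloisIndexTwoInvertedCyclic` (`A = C₄ × C_m` of index two, `x`
inverting `C_m`, `n = m ≥ 7`); for `|G| ≥ 64` also by gen 32's `CorCM/GaloisNonCentralInvolution` (a reflection is a non-central
involution).  The two small cases `m = 3` (`S₃ × C₄`, order `24` — note that `S₃ × C₂` is GOOD, gen 14) and `m = 5` (order `40`) are settled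
here by balanced-set certificates in gen 20's format (`exists_simple_degenerate_of_model_balanced`), found by the seat's census
(`scratch-g32/small_census.py`, `hxc4.py`: `576` of the `3720` primitive types of `S₃ × C₄` are degenerate).  Both pairs are MINIMAL BAD
pairs: all their CM quotients (`C₂ × C₄`, `C₄`, …) are GOOD.

References: Shimura (1998), §6.2 Thm. 3, §8.2 Prop. 26 [cite: Shimura1998]; Gordon (1999), Thm. 6.4, §9.3
[cite: Gordon1999HodgeAVSurvey].
-/

noncomputable section

open CategoryTheory CategoryTheory.Limits NumberField
open scoped BigOperators

namespace Summit.HodgeConjecture.CorCM.GaloisModels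

open Literature.NumberTheory.ComplexMultiplication
open Literature.AlgebraicGeometry.Motives (AbelianVariety CMType)
open Literature.AlgebraicGeometry.HodgeTheory
open Literature.AlgebraicGeometry.ComplexMultiplication (IsCMTypeRealisation)
open Literature.AlgebraicGeometry.Pohlmann1968
open Literature.Barriers.HodgeConjecture (divisorClassesSpan)
open DihedralGroup

variable {K : Type} [Field K] [NumberField K] [IsCMField K] [IsGalois ℚ K]

/-! ## §1 `S₃ × C₄` (order 24) -/

set_option maxRecDepth 8000 in
/-- The central elements of order `≤ 2` of `D_3 × C₄` (`DihedralGroup 3 × ℤ/4`) are `1` and `(1, 2)`. [folklore] -/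
theorem central_involution_dihedralThree_cyclicFour :
    ∀ x : DihedralGroup 3 × Multiplicative (ZMod 4), x * x = 1 → (∀ y, x * y = y * x) →
      x = 1 ∨ x = (r 0, Multiplicative.ofAdd 2) := by
  decide

set_option maxRecDepth 8000 in
/-- **`Gal(K/ℚ) ≅ D_3 × C₄` with complex conjugation `(1, 2)` — `K` = (totally real `D_3`-field) · (cyclic quartic CM field): a simple
DEGENERATE abelian `12`-fold with CM by `K`** (Kubota rank `9 < 13`; balanced set of `4` elements moved by `c`), with a
rational `(p,p)` class outside the divisor ring on some power. [cite: Shimura1998, §6.2 Thm. 3 and §8.2 Prop. 26]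
[cite: Gordon1999HodgeAVSurvey, Thm. 6.4] -/
theorem exists_simple_degenerate_of_dihedralThree_cyclicFour
    (e : (K ≃ₐ[ℚ] K) ≃* DihedralGroup 3 × Multiplicative (ZMod 4))
    (hc : e ((IsCMField.complexConj K).restrictScalars ℚ) = (r 0, Multiplicative.ofAdd 2)) :
    ∃ (Φ : CMType K) (φ₀ : K →+* ℂ) (A : AbelianVariety ℂ) (ι : 𝓞 K →+* End A)
      (θ : K →+* Module.End ℂ (complexBetti A.X 1)),
      IsPrimitive (ℂ ≃+* ℂ) Φ.1 φ₀ ∧ ¬ IsNondegenerate Φ ∧ IsCMTypeRealisation Φ A ι θ ∧ A.IsSimple ∧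
      A.dim = 12 ∧
      ∃ n p : ℕ, ∃ x : complexBetti (⨁ fun _ : Fin n => A).X (2 * p), IsRationalClass x ∧
        IsOfHodgeType (⨁ fun _ : Fin n => A).dim (⨁ fun _ : Fin n => A).X (2 * p) p p x ∧
        x ∉ divisorClassesSpan (⨁ fun _ : Fin n => A).X (⨁ fun _ : Fin n => A).dim p := by
  have h := exists_simple_degenerate_of_model_balanced e _ hc
    {(r 0, Multiplicative.ofAdd 2), (r 0, Multiplicative.ofAdd 3), (r 1, Multiplicative.ofAdd 1), (r 1, Multiplicative.ofAdd 2),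
      (r 2, Multiplicative.ofAdd 1), (r 2, Multiplicative.ofAdd 2), (sr 0, Multiplicative.ofAdd 2), (sr 0, Multiplicative.ofAdd 3),
      (sr 1, Multiplicative.ofAdd 2), (sr 1, Multiplicative.ofAdd 3), (sr 2, Multiplicative.ofAdd 1), (sr 2, Multiplicative.ofAdd 2)}
    (by decide) (by decide)
    {(r 1, Multiplicative.ofAdd 0), (r 2, Multiplicative.ofAdd 2), (sr 0, Multiplicative.ofAdd 0), (sr 1, Multiplicative.ofAdd 2)}
    (by decide) (by decide)
  rwa [Fintype.card_prod, DihedralGroup.card, Fintype.card_multiplicative, ZMod.card] at h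

/-- **`Gal(K/ℚ) ≅ D_3 × C₄` is BAD for the (unique) complex conjugation.** [cite: Shimura1998, §6.2 Thm. 3 and §8.2 Prop. 26]
[cite: Gordon1999HodgeAVSurvey, Thm. 6.4] -/
theorem exists_simple_degenerate_of_mulEquiv_dihedralThree_cyclicFour
    (e : (K ≃ₐ[ℚ] K) ≃* DihedralGroup 3 × Multiplicative (ZMod 4)) :
    ∃ (Φ : CMType K) (φ₀ : K →+* ℂ) (A : AbelianVariety ℂ) (ι : 𝓞 K →+* End A)
      (θ : K →+* Module.End ℂ (complexBetti A.X 1)),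
      IsPrimitive (ℂ ≃+* ℂ) Φ.1 φ₀ ∧ ¬ IsNondegenerate Φ ∧ IsCMTypeRealisation Φ A ι θ ∧ A.IsSimple ∧
      A.dim = 12 ∧
      ∃ n p : ℕ, ∃ x : complexBetti (⨁ fun _ : Fin n => A).X (2 * p), IsRationalClass x ∧
        IsOfHodgeType (⨁ fun _ : Fin n => A).dim (⨁ fun _ : Fin n => A).X (2 * p) p p x ∧
        x ∉ divisorClassesSpan (⨁ fun _ : Fin n => A).X (⨁ fun _ : Fin n => A).dim p := by
  set c₀ := e ((IsCMField.complexConj K).restrictScalars ℚ) with hc₀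
  have hcc : c₀ * c₀ = 1 := GaloisRank.model_complexConj_mul_self e rfl
  have hz : ∀ y, c₀ * y = y * c₀ := fun y => GaloisRank.model_complexConj_comm e rfl y
  have hne : c₀ ≠ 1 := GaloisRank.model_complexConj_ne_one e rfl
  rcases central_involution_dihedralThree_cyclicFour c₀ hcc hz with h | h
  · exact absurd h hne
  · exact exists_simple_degenerate_of_dihedralThree_cyclicFour e h

/-! ## §2 `D₅ × C₄` (order 40) -/

set_option maxRecDepth 8000 in
/-- The central elements of order `≤ 2` of `D_5 × C₄` (`DihedralGroup 5 × ℤ/4`) are `1` and `(1, 2)`. [folklore] -/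
theorem central_involution_dihedralFive_cyclicFour :
    ∀ x : DihedralGroup 5 × Multiplicative (ZMod 4), x * x = 1 → (∀ y, x * y = y * x) →
      x = 1 ∨ x = (r 0, Multiplicative.ofAdd 2) := by
  decide

set_option maxRecDepth 8000 in
/-- **`Gal(K/ℚ) ≅ D_5 × C₄` with complex conjugation `(1, 2)` — `K` = (totally real `D_5`-field) · (cyclic quartic CM field): a simple
DEGENERATE abelian `20`-fold with CM by `K`** (Kubota rank `19 < 21`; balanced set of `10` elements moved by `c`), with a
rational `(p,p)` class outside the divisor ring on some power. [cite: Shimura1998, §6.2 Thm. 3 and §8.2 Prop. 26]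
[cite: Gordon1999HodgeAVSurvey, Thm. 6.4] -/
theorem exists_simple_degenerate_of_dihedralFive_cyclicFour
    (e : (K ≃ₐ[ℚ] K) ≃* DihedralGroup 5 × Multiplicative (ZMod 4))
    (hc : e ((IsCMField.complexConj K).restrictScalars ℚ) = (r 0, Multiplicative.ofAdd 2)) :
    ∃ (Φ : CMType K) (φ₀ : K →+* ℂ) (A : AbelianVariety ℂ) (ι : 𝓞 K →+* End A)
      (θ : K →+* Module.End ℂ (complexBetti A.X 1)),
      IsPrimitive (ℂ ≃+* ℂ) Φ.1 φ₀ ∧ ¬ IsNondegenerate Φ ∧ IsCMTypeRealisation Φ A ι θ ∧ A.IsSimple ∧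
      A.dim = 20 ∧
      ∃ n p : ℕ, ∃ x : complexBetti (⨁ fun _ : Fin n => A).X (2 * p), IsRationalClass x ∧
        IsOfHodgeType (⨁ fun _ : Fin n => A).dim (⨁ fun _ : Fin n => A).X (2 * p) p p x ∧
        x ∉ divisorClassesSpan (⨁ fun _ : Fin n => A).X (⨁ fun _ : Fin n => A).dim p := by
  have h := exists_simple_degenerate_of_model_balanced e _ hc
    {(r 0, Multiplicative.ofAdd 0), (r 0, Multiplicative.ofAdd 3), (r 1, Multiplicative.ofAdd 1), (r 1, Multiplicative.ofAdd 2),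
      (r 2, Multiplicative.ofAdd 0), (r 2, Multiplicative.ofAdd 1), (r 3, Multiplicative.ofAdd 2), (r 3, Multiplicative.ofAdd 3),
      (r 4, Multiplicative.ofAdd 1), (r 4, Multiplicative.ofAdd 2), (sr 0, Multiplicative.ofAdd 2), (sr 0, Multiplicative.ofAdd 3),
      (sr 1, Multiplicative.ofAdd 1), (sr 1, Multiplicative.ofAdd 2), (sr 2, Multiplicative.ofAdd 0), (sr 2, Multiplicative.ofAdd 1),
      (sr 3, Multiplicative.ofAdd 0), (sr 3, Multiplicative.ofAdd 3), (sr 4, Multiplicative.ofAdd 1), (sr 4, Multiplicative.ofAdd 2)}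
    (by decide) (by decide)
    {(r 0, Multiplicative.ofAdd 0), (r 1, Multiplicative.ofAdd 0), (r 2, Multiplicative.ofAdd 0), (r 3, Multiplicative.ofAdd 0),
      (r 4, Multiplicative.ofAdd 0), (sr 0, Multiplicative.ofAdd 2), (sr 1, Multiplicative.ofAdd 2), (sr 2, Multiplicative.ofAdd 2),
      (sr 3, Multiplicative.ofAdd 2), (sr 4, Multiplicative.ofAdd 2)}
    (by decide) (by decide)
  rwa [Fintype.card_prod, DihedralGroup.card, Fintype.card_multiplicative, ZMod.card] at h

/-- **`Gal(K/ℚ) ≅ D_5 × C₄` is BAD for the (unique) complex conjugation.** [cite: Shimura1998, §6.2 Thm. 3 and §8.2 Prop. 26]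
[cite: Gordon1999HodgeAVSurvey, Thm. 6.4] -/
theorem exists_simple_degenerate_of_mulEquiv_dihedralFive_cyclicFour
    (e : (K ≃ₐ[ℚ] K) ≃* DihedralGroup 5 × Multiplicative (ZMod 4)) :
    ∃ (Φ : CMType K) (φ₀ : K →+* ℂ) (A : AbelianVariety ℂ) (ι : 𝓞 K →+* End A)
      (θ : K →+* Module.End ℂ (complexBetti A.X 1)),
      IsPrimitive (ℂ ≃+* ℂ) Φ.1 φ₀ ∧ ¬ IsNondegenerate Φ ∧ IsCMTypeRealisation Φ A ι θ ∧ A.IsSimple ∧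
      A.dim = 20 ∧
      ∃ n p : ℕ, ∃ x : complexBetti (⨁ fun _ : Fin n => A).X (2 * p), IsRationalClass x ∧
        IsOfHodgeType (⨁ fun _ : Fin n => A).dim (⨁ fun _ : Fin n => A).X (2 * p) p p x ∧
        x ∉ divisorClassesSpan (⨁ fun _ : Fin n => A).X (⨁ fun _ : Fin n => A).dim p := by
  set c₀ := e ((IsCMField.complexConj K).restrictScalars ℚ) with hc₀
  have hcc : c₀ * c₀ = 1 := GaloisRank.model_complexConj_mul_self e rfl
  have hz : ∀ y, c₀ * y = y * c₀ := fun y => GaloisRank.model_complexConj_comm e rfl y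
  have hne : c₀ ≠ 1 := GaloisRank.model_complexConj_ne_one e rfl
  rcases central_involution_dihedralFive_cyclicFour c₀ hcc hz with h | h
  · exact absurd h hne
  · exact exists_simple_degenerate_of_dihedralFive_cyclicFour e h

end Summit.HodgeConjecture.CorCM.GaloisModels

end
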